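import Mathlib
import Summits.Ventures.HodgeRepro.Tier4.Common.AdelicDefs
import Summits.Ventures.HodgeRepro.Tier4.Line1.RowBasis

/-!
# Tier4/Line1/RationalConjSystem — LINE L1, (iii′) `exists_rational_conj`, part 2: the line `W₀` over `𝔸_k`, the
normalisation `P₀ (S T) = P₀`, and the UNIQUENESS of the normalised system

Blind re-derivation cell `pub-hodge-repro`, Tier 4 «prove the step» (README §9–§10), seat t4-L1-p2 (prover, gen 0),
LINE L1, assignment S12586 (plan-1 g1): (iii′) the core of J2.b.  This module: `exists_row_coords` — every adelic row
vector fixed by `P₀` lies in the `𝔸_k`-span of the rational `w, wΩ` (coordinates with respect to the row basis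
`w, wΩ, w₁, w₁Ω`); `row_coords_unique`; `vecMul_scalar_mul_self` and `adMat_P0_mul_scalar_mul` — with `S = x·1 − y·Ω`
the inverse of the scalar `x + yΩ` by which `T` acts on `W₀`, `S T` is the identity on `W₀`, i.e. `P₀ (S T) = P₀`
(the NORMALISATION that pins the solution of the rational system down); `sys_unique` — the homogeneous system
«`Y` commutes with `Ω, P₀, P₁`; `Y′` with `Ω, Q₀, Q₁`; `Y Γ₀ = Γ Y′`; `P₀ Y = 0`» has only the zero solution for
`Γ = T Γ₀ T′⁻¹` and a linearly regular `γ₀` (regularity leaves a scalar `x′ + y′Ω`, killed by `P₀ Y = 0` through the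
rational `2 × 2` system `[[x, −dy], [y, x]]` of determinant `x² + dy² = 1`, a UNIT of `𝔸_k` — the one step where an
adelic zero divisor could have bitten, and does not).

Nothing here says anything about the status of the Hodge conjecture for CM abelian varieties, which is NOT proved
(HC_CM is NOT proved by anyone in this repository).
-/

set_option autoImplicit false

noncomputable section

namespace Summit.Ventures.HodgeRepro.Tier4.Line1

open Matrix NumberField Summit.Ventures.HodgeRepro.Tier4.Common


/-! ### the line `W₀` over `𝔸`, the normalisation `P₀ (S t) = P₀`, and the uniqueness of the system -/

section Conj3

variable {k : Type} [Field k] [NumberField k] (W : PlaneData k)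

/-- every adelic row vector fixed by `P₀` lies in the `𝔸`-span of `w, wΩ` -/
theorem exists_row_coords {d : k} (hΩ : W.Ω * W.Ω = -(d • (1 : Matrix (Fin 4) (Fin 4) k)))
    (hd : ¬ IsSquare (-d)) {w w₁ : Fin 4 → k} (h0 : w ≠ 0) (h1 : w₁ ≠ 0)
    (hP0 : w ᵥ* W.P 0 = w) (hP1 : w₁ ᵥ* W.P 0 = 0) {v : Fin 4 → Ad k}
    (hv : v ᵥ* adMat k (W.P 0) = v) :
    ∃ x y : Ad k, v = x • (algebraMap k (Ad k) ∘ w) + y • (algebraMap k (Ad k) ∘ (w ᵥ* W.Ω)) := by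
  have hdet := det_rowMat_ne_zero W hΩ hd h0 h1 hP0 hP1
  obtain ⟨c, hc⟩ := exists_vecMul_eq hdet v
  have hPΩ : ∀ x : Fin 4 → k, (x ᵥ* W.Ω) ᵥ* W.P 0 = (x ᵥ* W.P 0) ᵥ* W.Ω := by
    intro x
    rw [Matrix.vecMul_vecMul, Matrix.vecMul_vecMul, W.P_comm 0]
  have hP0E : ∀ c : Fin 4 → Ad k,
      (c ᵥ* adMat k (Matrix.of fun i j => (![w, w ᵥ* W.Ω, w₁, w₁ ᵥ* W.Ω] i) j)) ᵥ* adMat k (W.P 0) =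
        ![c 0, c 1, 0, 0] ᵥ* adMat k (Matrix.of fun i j => (![w, w ᵥ* W.Ω, w₁, w₁ ᵥ* W.Ω] i) j) := by
    intro c
    rw [vecMul_adMat_rowMat, vecMul_adMat_rowMat]
    simp only [Matrix.add_vecMul, Matrix.smul_vecMul, vecMul_adMat_algebraMap_comp, hP0, hPΩ, hP1,
      Matrix.zero_vecMul, Matrix.cons_val_zero, Matrix.cons_val_one, Matrix.cons_val_two,
      Matrix.cons_val_three, Matrix.head_cons, Matrix.tail_cons, zero_smul, add_zero]
    have h0' : (algebraMap k (Ad k)) ∘ (0 : Fin 4 → k) = 0 := by funext i; simp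
    rw [h0', smul_zero, smul_zero, add_zero, add_zero]
  have hc' : c = ![c 0, c 1, 0, 0] := by
    apply vecMul_injective_of_det_ne_zero hdet
    rw [← hP0E, hc, hv]
  have hc2 : c 2 = 0 := by
    have := congrFun hc' 2
    simpa using this
  have hc3 : c 3 = 0 := by
    have := congrFun hc' 3
    simpa using this
  refine ⟨c 0, c 1, ?_⟩
  rw [← hc, vecMul_adMat_rowMat, hc2, hc3, zero_smul, zero_smul, add_zero, add_zero]

/-- the pair of coordinates of a vector of the line `W₀` with respect to `w, wΩ` is unique -/
theorem row_coords_unique {d : k} (hΩ : W.Ω * W.Ω = -(d • (1 : Matrix (Fin 4) (Fin 4) k)))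
    (hd : ¬ IsSquare (-d)) {w w₁ : Fin 4 → k} (h0 : w ≠ 0) (h1 : w₁ ≠ 0)
    (hP0 : w ᵥ* W.P 0 = w) (hP1 : w₁ ᵥ* W.P 0 = 0) {a b : Ad k}
    (h : a • (algebraMap k (Ad k) ∘ w) + b • (algebraMap k (Ad k) ∘ (w ᵥ* W.Ω)) = 0) : a = 0 ∧ b = 0 := by
  have hdet := det_rowMat_ne_zero W hΩ hd h0 h1 hP0 hP1
  have hc : (![a, b, 0, 0] : Fin 4 → Ad k) = 0 := by
    apply vecMul_injective_of_det_ne_zero hdet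
    rw [vecMul_adMat_rowMat, Matrix.zero_vecMul]
    simp only [Matrix.cons_val_zero, Matrix.cons_val_one, Matrix.cons_val_two, Matrix.cons_val_three,
      Matrix.head_cons, Matrix.tail_cons, zero_smul, add_zero]
    exact h
  constructor
  · have := congrFun hc 0
    simpa using this
  · have := congrFun hc 1
    simpa using this

/-- the action of `S T` (`S = x·1 − y·Ω` the inverse scalar) on `w`: `w S T = w` -/
theorem vecMul_scalar_mul_self {d : k} (hΩ : W.Ω * W.Ω = -(d • (1 : Matrix (Fin 4) (Fin 4) k)))
    {w : Fin 4 → k} {T : M4 k} (hTΩ : T * adMat k W.Ω = adMat k W.Ω * T) {x y : Ad k}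
    (hxy : (algebraMap k (Ad k) ∘ w) ᵥ* T =
      x • (algebraMap k (Ad k) ∘ w) + y • (algebraMap k (Ad k) ∘ (w ᵥ* W.Ω)))
    (hn : x * x + algebraMap k (Ad k) d * (y * y) = 1) :
    (algebraMap k (Ad k) ∘ w) ᵥ* ((x • (1 : M4 k) - y • adMat k W.Ω) * T) = algebraMap k (Ad k) ∘ w := by
  have hwΩT : (algebraMap k (Ad k) ∘ (w ᵥ* W.Ω)) ᵥ* T =
      x • (algebraMap k (Ad k) ∘ (w ᵥ* W.Ω)) -
        (y * algebraMap k (Ad k) d) • (algebraMap k (Ad k) ∘ w) := by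
    rw [← vecMul_adMat_algebraMap_comp, Matrix.vecMul_vecMul, ← hTΩ, ← Matrix.vecMul_vecMul, hxy,
      Matrix.add_vecMul, Matrix.smul_vecMul, Matrix.smul_vecMul, vecMul_adMat_algebraMap_comp,
      vecMul_adMat_algebraMap_comp, vecMul_vecMul_Omega W hΩ]
    have : (algebraMap k (Ad k)) ∘ (-(d • w)) = -(algebraMap k (Ad k) d • (algebraMap k (Ad k) ∘ w)) := by
      funext i; simp [map_neg, map_mul, Algebra.smul_def]
    rw [this, smul_neg, smul_smul, sub_eq_add_neg]
  rw [← Matrix.vecMul_vecMul, Matrix.vecMul_sub, Matrix.vecMul_smul, Matrix.vecMul_smul, Matrix.vecMul_one,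
    vecMul_adMat_algebraMap_comp, Matrix.sub_vecMul, Matrix.smul_vecMul, Matrix.smul_vecMul, hxy, hwΩT]
  trans (x * x + algebraMap k (Ad k) d * (y * y)) • (algebraMap k (Ad k) ∘ w)
  · module
  · rw [hn, one_smul]

/-- `P₀ (S T) = P₀`: `S T` is the identity on the line `W₀` -/
theorem adMat_P0_mul_scalar_mul {d : k} (hΩ : W.Ω * W.Ω = -(d • (1 : Matrix (Fin 4) (Fin 4) k)))
    (hd : ¬ IsSquare (-d)) {w w₁ : Fin 4 → k} (h0 : w ≠ 0) (h1 : w₁ ≠ 0)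
    (hP0 : w ᵥ* W.P 0 = w) (hP1 : w₁ ᵥ* W.P 0 = 0) {T : M4 k}
    (hTΩ : T * adMat k W.Ω = adMat k W.Ω * T) {x y : Ad k}
    (hxy : (algebraMap k (Ad k) ∘ w) ᵥ* T =
      x • (algebraMap k (Ad k) ∘ w) + y • (algebraMap k (Ad k) ∘ (w ᵥ* W.Ω)))
    (hn : x * x + algebraMap k (Ad k) d * (y * y) = 1) :
    adMat k (W.P 0) * ((x • (1 : M4 k) - y • adMat k W.Ω) * T) = adMat k (W.P 0) := by
  set D : M4 k := (x • (1 : M4 k) - y • adMat k W.Ω) * T with hD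
  have hDΩ : D * adMat k W.Ω = adMat k W.Ω * D := by
    rw [hD, Matrix.mul_assoc, hTΩ, ← Matrix.mul_assoc, ← Matrix.mul_assoc]
    congr 1
    rw [Matrix.sub_mul, Matrix.mul_sub, Matrix.smul_mul, Matrix.mul_smul, Matrix.smul_mul, Matrix.mul_smul,
      Matrix.one_mul, Matrix.mul_one]
  have hw : (algebraMap k (Ad k) ∘ w) ᵥ* D = algebraMap k (Ad k) ∘ w :=
    vecMul_scalar_mul_self W hΩ hTΩ hxy hn
  have hwΩ : (algebraMap k (Ad k) ∘ (w ᵥ* W.Ω)) ᵥ* D = algebraMap k (Ad k) ∘ (w ᵥ* W.Ω) := by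
    rw [← vecMul_adMat_algebraMap_comp, Matrix.vecMul_vecMul, ← hDΩ, ← Matrix.vecMul_vecMul, hw]
  -- every row of `adMat P₀` is fixed by `D`
  have hrow : ∀ i : Fin 4, (adMat k (W.P 0)).row i ᵥ* D = (adMat k (W.P 0)).row i := by
    intro i
    have hrat : (adMat k (W.P 0)).row i = algebraMap k (Ad k) ∘ (W.P 0).row i := by
      funext j
      rfl
    have hfix : ((W.P 0).row i) ᵥ* W.P 0 = (W.P 0).row i := by
      have : (W.P 0).row i = Pi.single i (1 : k) ᵥ* W.P 0 := by
        rw [Matrix.single_vecMul, one_smul]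
      rw [this, Matrix.vecMul_vecMul, W.P_idem 0]
    have hfixR : (adMat k (W.P 0)).row i ᵥ* adMat k (W.P 0) = (adMat k (W.P 0)).row i := by
      rw [hrat, vecMul_adMat_algebraMap_comp, hfix]
    obtain ⟨a, b, hab⟩ := exists_row_coords W hΩ hd h0 h1 hP0 hP1 hfixR
    rw [hab, Matrix.add_vecMul, Matrix.smul_vecMul, Matrix.smul_vecMul, hw, hwΩ]
  ext i j
  have := congrFun (hrow i) j
  exact this

end Conj3

/-! ### uniqueness of the normalised system -/

section Conj4

variable {k : Type} [Field k] [NumberField k] (W : PlaneData k)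

/-- UNIQUENESS: the homogeneous system «`Y` commutes with `Ω, P₀, P₁`; `Y′` with `Ω, Q₀, Q₁`; `Y Γ₀ = Γ Y′`;
`P₀ Y = 0`» has only the zero solution, for `Γ = T Γ₀ T′⁻¹` with `T ∈ T(𝔸)`, `T′ ∈ T′(𝔸)` and a linearly regular
`γ₀` (the scalar `(x′, y′)` left by regularity is killed by `P₀ Y = 0` through the rational `2 × 2` system
`[[x, −dy], [y, x]]` whose determinant `x² + dy² = 1` is a unit). -/
theorem sys_unique {d : k} (hΩ : W.Ω * W.Ω = -(d • (1 : Matrix (Fin 4) (Fin 4) k)))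
    (hd : ¬ IsSquare (-d)) {w w₁ : Fin 4 → k} (h0 : w ≠ 0) (h1 : w₁ ≠ 0)
    (hP0 : w ᵥ* W.P 0 = w) (hP1 : w₁ ᵥ* W.P 0 = 0)
    {T Ti T' Ti' Γ Γ₀ : M4 k} (hTiT : Ti * T = 1) (hTTi : T * Ti = 1) (hT'Ti' : T' * Ti' = 1)
    (hTiΩ : Ti * adMat k W.Ω = adMat k W.Ω * Ti)
    (hTiP : ∀ i, Ti * adMat k (W.P i) = adMat k (W.P i) * Ti)
    (hTi'Ω : Ti' * adMat k W.Ω = adMat k W.Ω * Ti')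
    (hTi'Q : ∀ i, Ti' * adMat k (W.Q i) = adMat k (W.Q i) * Ti')
    (hΓ : Γ * T' = T * Γ₀)
    (hreg : ∀ Y Y' : M4 k, Y * adMat k W.Ω = adMat k W.Ω * Y →
      (∀ i, Y * adMat k (W.P i) = adMat k (W.P i) * Y) → Y' * adMat k W.Ω = adMat k W.Ω * Y' →
      (∀ i, Y' * adMat k (W.Q i) = adMat k (W.Q i) * Y') → Y * Γ₀ = Γ₀ * Y' →
      ∃ x y : Ad k, Y = x • (1 : M4 k) + y • adMat k W.Ω ∧ Y' = x • (1 : M4 k) + y • adMat k W.Ω)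
    {x y : Ad k} (hxy : (algebraMap k (Ad k) ∘ w) ᵥ* T =
      x • (algebraMap k (Ad k) ∘ w) + y • (algebraMap k (Ad k) ∘ (w ᵥ* W.Ω)))
    (hn : x * x + algebraMap k (Ad k) d * (y * y) = 1)
    {Y Y' : M4 k} (hYΩ : Y * adMat k W.Ω = adMat k W.Ω * Y)
    (hYP : ∀ i, Y * adMat k (W.P i) = adMat k (W.P i) * Y)
    (hY'Ω : Y' * adMat k W.Ω = adMat k W.Ω * Y')
    (hY'Q : ∀ i, Y' * adMat k (W.Q i) = adMat k (W.Q i) * Y')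
    (hYΓ : Y * Γ₀ = Γ * Y') (hP0Y : adMat k (W.P 0) * Y = 0) : Y = 0 ∧ Y' = 0 := by
  -- `Γ = T Γ₀ Ti'`
  have hΓ' : Γ = T * Γ₀ * Ti' := by
    rw [← hΓ, Matrix.mul_assoc, hT'Ti', Matrix.mul_one]
  -- the normalised pair
  have hY₁Ω : (Ti * Y) * adMat k W.Ω = adMat k W.Ω * (Ti * Y) := by
    rw [Matrix.mul_assoc, hYΩ, ← Matrix.mul_assoc, hTiΩ, Matrix.mul_assoc]
  have hY₁P : ∀ i, (Ti * Y) * adMat k (W.P i) = adMat k (W.P i) * (Ti * Y) := fun i => by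
    rw [Matrix.mul_assoc, hYP i, ← Matrix.mul_assoc, hTiP i, Matrix.mul_assoc]
  have hY₁'Ω : (Ti' * Y') * adMat k W.Ω = adMat k W.Ω * (Ti' * Y') := by
    rw [Matrix.mul_assoc, hY'Ω, ← Matrix.mul_assoc, hTi'Ω, Matrix.mul_assoc]
  have hY₁'Q : ∀ i, (Ti' * Y') * adMat k (W.Q i) = adMat k (W.Q i) * (Ti' * Y') := fun i => by
    rw [Matrix.mul_assoc, hY'Q i, ← Matrix.mul_assoc, hTi'Q i, Matrix.mul_assoc]
  have hY₁Γ : (Ti * Y) * Γ₀ = Γ₀ * (Ti' * Y') := by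
    rw [Matrix.mul_assoc, hYΓ, hΓ', ← Matrix.mul_assoc, ← Matrix.mul_assoc, ← Matrix.mul_assoc, hTiT,
      Matrix.one_mul, Matrix.mul_assoc]
  obtain ⟨x', y', hY₁, hY₁'⟩ := hreg _ _ hY₁Ω hY₁P hY₁'Ω hY₁'Q hY₁Γ
  -- `Y = T (x' + y' Ω)`, `Y' = T' (x' + y' Ω)`
  have hY : Y = T * (x' • (1 : M4 k) + y' • adMat k W.Ω) := by
    rw [← hY₁, ← Matrix.mul_assoc, hTTi, Matrix.one_mul]
  have hY' : Y' = T' * (x' • (1 : M4 k) + y' • adMat k W.Ω) := by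
    rw [← hY₁', ← Matrix.mul_assoc, hT'Ti', Matrix.one_mul]
  -- `w Y = 0`
  have hwY : (algebraMap k (Ad k) ∘ w) ᵥ* Y = 0 := by
    have : (algebraMap k (Ad k) ∘ w) ᵥ* adMat k (W.P 0) = algebraMap k (Ad k) ∘ w := by
      rw [vecMul_adMat_algebraMap_comp, hP0]
    rw [← this, Matrix.vecMul_vecMul, hP0Y, Matrix.vecMul_zero]
  -- expand `w Y` in the basis
  have hexp : (algebraMap k (Ad k) ∘ w) ᵥ* Y =
      (x * x' - algebraMap k (Ad k) d * (y * y')) • (algebraMap k (Ad k) ∘ w) +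
        (x * y' + y * x') • (algebraMap k (Ad k) ∘ (w ᵥ* W.Ω)) := by
    rw [hY, ← Matrix.vecMul_vecMul, hxy, Matrix.add_vecMul, Matrix.smul_vecMul, Matrix.smul_vecMul,
      Matrix.vecMul_add, Matrix.vecMul_add, Matrix.vecMul_smul, Matrix.vecMul_smul, Matrix.vecMul_smul,
      Matrix.vecMul_smul, Matrix.vecMul_one, Matrix.vecMul_one, vecMul_adMat_algebraMap_comp,
      vecMul_adMat_algebraMap_comp, vecMul_vecMul_Omega W hΩ]
    have : (algebraMap k (Ad k)) ∘ (-(d • w)) = -(algebraMap k (Ad k) d • (algebraMap k (Ad k) ∘ w)) := by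
      funext i; simp [map_neg, map_mul, Algebra.smul_def]
    rw [this]
    module
  rw [hwY] at hexp
  obtain ⟨h₁, h₂⟩ := row_coords_unique W hΩ hd h0 h1 hP0 hP1 hexp.symm
  -- solve the `2 × 2` system with determinant `1`
  have hx' : x' = 0 := by
    have : x' = (x * x + algebraMap k (Ad k) d * (y * y)) * x' := by rw [hn, one_mul]
    rw [this]
    linear_combination x * h₁ + algebraMap k (Ad k) d * y * h₂
  have hy' : y' = 0 := by
    have : y' = (x * x + algebraMap k (Ad k) d * (y * y)) * y' := by rw [hn, one_mul]
    rw [this]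
    linear_combination x * h₂ - y * h₁
  subst hx' hy'
  simp only [zero_smul, add_zero, Matrix.mul_zero] at hY hY'
  exact ⟨hY, hY'⟩

end Conj4

end Summit.Ventures.HodgeRepro.Tier4.Line1

end
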